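import Literature.MathematicalPhysics.QuantumFieldTheory.Balaban1983to89.B9Eq310DeltaPrime
import Literature.MathematicalPhysics.QuantumFieldTheory.Balaban1983to89.B11Eq103H1Complex

/-!
# `Balaban1983to89.B9Eq310HessianOperator` — T. Bałaban, *Propagators for lattice gauge theories in a background field*, Commun. Math. Phys.
# **99** (1985) 389–434 [Balaban1985BackgroundPropagators], (3.10) p. 392 with p. 391 (*«The adjoints are taken with respect to natural L²
# scalar products for functions with values in N × N hermitian matrices. The inner product for these matrices is defined by X·Y = tr XY»*)
# and [Balaban1985Averaging] (18) p. 21 (`‖X‖² = tr X*X`): THE CURVATURE PART `Δ′` OF (3.10) AS AN OPERATOR on the `L²` space of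
# `𝔤ᶜ`-valued bond functions — the operator of the bilinear form `B9Eq310DeltaPrime.curvForm` against the scalar product `⟨X, Y⟩ = tr X*Y`
# (Riesz on the finite lattice), so that the Hessian letter `Δ₁ = D*D + Δ′` of `G₁ = (Δ₁ + DRD* + aQ*Q)⁻¹` is an OBJECT determined by the
# background `U`, the trace `τ` and the transporters

statement-level skeleton of published theorems with citation tags; proofs where landed; nothing here is a claim
about the Yang–Mills mass gap

PDF held: `paper:balaban1985-cmp99-background-propagators` (journal page = PDF page + 388), pp. 391–392 read by this seat (2026-08-21) on the
renders `pub-balaban/b2b-balaban-ref1/pages/1985-cmp99-background-propagators/…-p003-x2.png`, `…-p004-x2.png`; the verbatim text of (3.10) and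
of (3.2)/(3.4)/(3.7) is quoted in the header of `B9Eq310DeltaPrime`.

THE PRINT (verbatim, p. 392).  *«The quadratic terms in the expansion (3.7) define the basic operator generalizing the operator ∂*∂ in the
Abelian case. We denote it by Δ^η(U), or simply by Δ. For U with values in the unitary group U(N) it is a hermitian operator given by the
quadratic form ⟨A, ΔA⟩ = ⟨A, D*DA⟩ + ⟨A, Δ′A⟩, ⟨A, Δ′A⟩ = Σ_{p⊂T_η} η^d tr((D¹_U A)(p))²η⁻²(Re U(∂p) − 1) + tr Σ_{b₁,b₂⊂∂(p)_z, b₁≺b₂}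
i[A′(b₁), A′(b₂)]η⁻² Im U(∂p). (3.10)»*

WHY THIS FILE (cell context).  `B9Eq310DeltaPrime` (pub-balaban NE9 owner, gen 77) typed `⟨A, Δ′B⟩` as a complex-BILINEAR form `curvForm τ η U`
on the `𝔤ᶜ`-valued bond functions, leaving *«(M2) the operator Δ′ on the L² space (Riesz against ⟨X, Y⟩ = tr X*Y) … next brick»*.  This is that
brick: an operator «given by the quadratic form» is, on the finite lattice, the Riesz representative of the form — here constructed for ANY
sesquilinear form on a finite-dimensional Hilbert space through an orthonormal basis (`opOfSesq`, `⟪x, T_S y⟫ = S(x, y)`), and applied to the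
sesquilinear reading `(f, g) ↦ curvForm(τ)(Φf)*(Φg)` of the curvature form on the weighted `L²` bond space of `B11Eq103H1Complex` (Hilbert
fibre `W`, carrier algebra `𝔸 ⊇ 𝔤ᶜ` with its `*`, identification `φ : W ≃ₗ[ℂ] 𝔸`, cf. [B7] (18)–(19)).  With it the Hessian letter of
`B11Eq103H1Complex.laplaceALatticeK` can be TAKEN `:= D*D + curvOp …` — an object of `U`.

WHAT IS DEFINED AND PROVED (sorry-free; no `Prop` placeholder; no inequality of the paper).
* §1 **`opOfSesq S`** — the operator of a sesquilinear form `S : E →ₗ⋆[𝕜] E →ₗ[𝕜] 𝕜` on a finite-dimensional `𝕜`-Hilbert space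
  (`Σ_i S(b_i, ·) b_i` over `stdOrthonormalBasis`); **`inner_opOfSesq`**: `⟪x, opOfSesq S y⟫ = S x y`; `opOfSesq_eq_zero_of_forall`.
* §2 `star∘Φ` bookkeeping; **`curvSesq φ τ η U`** : `BondL2K ℂ d Pd c₀ W →ₗ⋆[ℂ] BondL2K ℂ d Pd c₀ W →ₗ[ℂ] ℂ` — `(f, g) ↦ curvForm τ η U (Φf)* (Φg)`
  (`Φ = B11Eq103H1Complex.funEquiv φ`, `*` pointwise; conjugate-linear in `f` by `StarModule ℂ 𝔸`); **`curvOp φ τ η U`** : `BondL2K … →ₗ[ℂ] BondL2K …`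
  = THE OPERATOR `Δ′` with **`inner_curvOp`**: `⟪f, Δ′g⟫ = ⟨(Φf)*, Δ′(Φg)⟩_{(3.10)}`; **`curvOp_one`** (`Δ′ = 0` at the flat background).
* §3a `sum_inner_covCurl_eq_sum_inner_covCoCurl_K` ((3.9) = the `ℓ²`-adjoint of (3.4) for `𝕜`-fibres, `conj c = c`), `PlaqL2K`, `covCurlL2K`,
  `covCoCurlL2K`, **`adjoint_covCurlL2K`** (`D* = D†` for the curl), `inner_covCoCurlL2K_covCurlL2K` (`⟨A, D*DA⟩ = ‖DA‖²`), `covCoCurlL2K_comp_isSymmetric`.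
* §3 `adTransportW φ U` (the transporters `R(U(b))` read on the Hilbert fibre along `φ`), **`principalOpK`** (+ `principalOpK_eq_comp`,
  **`principalOpK_isSymmetric`** under the displayed adjointness of the transporters) (`D*D` of (3.10) on `BondL2K` over `ℂ`:
  `B9Eq34CovCurlVector.covLapPrincipal` read through the identifications, adjoint transporters `R(U(b)⁻¹)`), **`hessOp φ η U τ := D*D + Δ′`** —
  THE HESSIAN `Δ^η(U)` AS AN OPERATOR; `hessOp_one` (flat: `Δ = D*D`, «∂*∂ in the Abelian case»).
MODEL / DECLARED READINGS.  (M1) as `B9Eq310DeltaPrime` (M1) and `B11Eq103H1Complex` (M1): two normings of `𝔤ᶜ` identified by `φ`, trace datum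
`τ`, uniform weight `c₀ = η^d`.  (M2) the compatibility `⟪φ⁻¹X, φ⁻¹Y⟫ = τ(X*Y)` that makes `Δ′` the printed operator, and its HERMITICITY for
unitary `U` (*«for U with values in the unitary group U(N) it is a hermitian operator»* — needs `τ(X*) = conj τ(X)`, trace cyclicity and
`U(b)* = U(b)⁻¹`) are NOT proved here (displayed where consumed, e.g. as `hΔ : Δ₁.IsSymmetric` in `B11Eq103H1Complex.laplaceALatticeK_isSymmetric`).
(M3) NOT HERE: any bound on `Δ′`.
HONEST SCOPE.  [folklore] finite-dimensional Riesz representation + bookkeeping realising a printed operator as an object; no estimate of the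
paper; NOT summit progress (cell pub-balaban: NE9 NOT PRINTED / NOT PROVED; spine PROVED 0/9).  Filed by the pub-balaban NE9 BINDER-row owner
lineage `b2b-balaban-t4-ne9-p1` (gen 77); a NEW file importing `B9Eq310DeltaPrime` and `B11Eq103H1Complex`; nothing else modified.  Net new
unproved facts: 0.
-/

noncomputable section

open scoped InnerProductSpace ComplexConjugate BigOperators

namespace Literature.MathematicalPhysics.QuantumFieldTheory.Balaban1983to89.B9Eq310HessianOperator

/-! ## §1 The operator of a sesquilinear form on a finite-dimensional Hilbert space (Riesz through an orthonormal basis) -/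

section OpOfSesq

variable {𝕜 : Type*} [RCLike 𝕜] {E : Type*} [NormedAddCommGroup E] [InnerProductSpace 𝕜 E] [FiniteDimensional 𝕜 E]

/-- **The operator `T_S` of a sesquilinear form `S`** (conjugate-linear in the first slot, linear in the second) on a finite-dimensional
Hilbert space: `T_S y = Σ_i S(b_i, y) b_i` for the standard orthonormal basis `b` — the object meant by *«a hermitian operator given by the
quadratic form»* ((3.10)) on a finite lattice. [cite: Balaban1985BackgroundPropagators, (3.10) p.392] -/
def opOfSesq (S : E →ₗ⋆[𝕜] E →ₗ[𝕜] 𝕜) : E →ₗ[𝕜] E :=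
  ∑ i, (S (stdOrthonormalBasis 𝕜 E i)).smulRight (stdOrthonormalBasis 𝕜 E i)

/-- Unfolding: `T_S y = Σ_i S(b_i, y) • b_i`. [cite: Balaban1985BackgroundPropagators, (3.10) p.392] -/
theorem opOfSesq_apply (S : E →ₗ⋆[𝕜] E →ₗ[𝕜] 𝕜) (y : E) :
    opOfSesq S y = ∑ i, S (stdOrthonormalBasis 𝕜 E i) y • stdOrthonormalBasis 𝕜 E i := by
  simp [opOfSesq, LinearMap.sum_apply, LinearMap.smulRight_apply]

/-- **`⟪x, T_S y⟫ = S(x, y)`** — the operator REPRESENTS the form (expand `x = Σ_i ⟪b_i, x⟫ b_i`). [cite: Balaban1985BackgroundPropagators, (3.10) p.392] -/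
theorem inner_opOfSesq (S : E →ₗ⋆[𝕜] E →ₗ[𝕜] 𝕜) (x y : E) : ⟪x, opOfSesq S y⟫_𝕜 = S x y := by
  conv_rhs => rw [← (stdOrthonormalBasis 𝕜 E).sum_repr' x]
  simp only [opOfSesq_apply, inner_sum, inner_smul_right, map_sum, LinearMap.sum_apply, LinearMap.map_smulₛₗ, LinearMap.smul_apply,
    smul_eq_mul, inner_conj_symm]
  exact Finset.sum_congr rfl fun i _ => mul_comm _ _

/-- A form that vanishes identically has the zero operator. [cite: Balaban1985BackgroundPropagators, (3.10) p.392] -/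
theorem opOfSesq_eq_zero_of_forall (S : E →ₗ⋆[𝕜] E →ₗ[𝕜] 𝕜) (hS : ∀ x y, S x y = 0) : opOfSesq S = 0 := by
  apply LinearMap.ext
  intro y
  apply ext_inner_left 𝕜
  intro x
  rw [inner_opOfSesq, hS, LinearMap.zero_apply, inner_zero_right]

end OpOfSesq

/-! ## §2 The curvature operator `Δ′` on the `L²` space of `𝔤ᶜ`-valued bond functions -/

section Curv

open B9SectCLatticeCarrier (Bond)
open B4Sect5Torus (TSite)
open B9Eq311L2Pairing (WL2)
open B9Eq310DeltaPrime (curvForm curvForm_one)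
open B11Eq103H1Complex (BondL2K funEquiv funEquiv_apply)

variable {d : ℕ} {Pd : Fin d → ℕ} {𝔸 : Type*} [Ring 𝔸] [Algebra ℂ 𝔸] {W : Type*} [NormedAddCommGroup W] [InnerProductSpace ℂ W]
  (φ : W ≃ₗ[ℂ] 𝔸) {c₀ : ℝ}

/-- A bond function of the `L²` space READ IN THE ALGEBRA: `Φf = φ ∘ f` (`B11Eq103H1Complex.funEquiv`). [cite: Balaban1985Averaging, (18)–(19) p.21] -/
abbrev toAlg (f : BondL2K ℂ d Pd c₀ W) : Bond d Pd → 𝔸 := funEquiv φ (fun _ : Bond d Pd => c₀) f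

/-- `Φ` is additive. [cite: Balaban1985Averaging, (18) p.21] -/
theorem toAlg_add (f g : BondL2K ℂ d Pd c₀ W) : toAlg φ (f + g) = toAlg φ f + toAlg φ g := map_add _ _ _

/-- `Φ` is homogeneous. [cite: Balaban1985Averaging, (18) p.21] -/
theorem toAlg_smul (c : ℂ) (f : BondL2K ℂ d Pd c₀ W) : toAlg φ (c • f) = c • toAlg φ f := map_smul _ _ _

variable [StarRing 𝔸] [StarModule ℂ 𝔸] (τ : 𝔸 →ₗ[ℂ] ℂ) (η : ℝ) (U : Bond d Pd → 𝔸ˣ)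

/-- **The curvature form read SESQUILINEARLY on the `L²` bond space**: `(f, g) ↦ ⟨(Φf)*, Δ′(Φg)⟩_{(3.10)} = curvForm τ η U (Φf)* (Φg)` — conjugate-linear
in `f` (pointwise `*` on `𝔸`, `StarModule ℂ 𝔸`), linear in `g`; for hermitian-valued `f = g` it is print's `⟨A, Δ′A⟩`.
[cite: Balaban1985BackgroundPropagators, (3.10) p.392, p.391] -/
def curvSesq : BondL2K ℂ d Pd c₀ W →ₗ⋆[ℂ] BondL2K ℂ d Pd c₀ W →ₗ[ℂ] ℂ :=
  LinearMap.mk₂'ₛₗ (starRingEnd ℂ) (RingHom.id ℂ) (fun f g => curvForm τ η U (star (toAlg φ f)) (toAlg φ g))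
    (fun f₁ f₂ g => by rw [toAlg_add, star_add, map_add, LinearMap.add_apply])
    (fun c f g => by rw [toAlg_smul, star_smul, RCLike.star_def, map_smul, LinearMap.smul_apply, smul_eq_mul])
    (fun f g₁ g₂ => by rw [toAlg_add, map_add])
    (fun c f g => by rw [toAlg_smul, map_smul, RingHom.id_apply])

/-- Unfolding the sesquilinear form. [cite: Balaban1985BackgroundPropagators, (3.10) p.392] -/
@[simp] theorem curvSesq_apply (f g : BondL2K ℂ d Pd c₀ W) :
    curvSesq φ τ η U f g = curvForm τ η U (star (toAlg φ f)) (toAlg φ g) := rfl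

variable [FiniteDimensional ℂ W] [Fact (0 < c₀)]

/-- **THE OPERATOR `Δ′ = Δ′^η(U)` ON THE `L²` SPACE OF `𝔤ᶜ`-VALUED BOND FUNCTIONS** — the Riesz representative of the curvature form (3.10).
[cite: Balaban1985BackgroundPropagators, (3.10) p.392] -/
def curvOp : BondL2K ℂ d Pd c₀ W →ₗ[ℂ] BondL2K ℂ d Pd c₀ W := opOfSesq (curvSesq φ τ η U)

/-- **`⟪f, Δ′g⟫ = curvForm τ η U (Φf)* (Φg)`** — `Δ′` is «given by the quadratic form» (3.10). [cite: Balaban1985BackgroundPropagators, (3.10) p.392] -/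
theorem inner_curvOp (f g : BondL2K ℂ d Pd c₀ W) : ⟪f, curvOp φ τ η U g⟫_ℂ = curvForm τ η U (star (toAlg φ f)) (toAlg φ g) := by
  rw [curvOp, inner_opOfSesq, curvSesq_apply]

/-- **`Δ′ = 0` AT THE FLAT BACKGROUND** (`U ≡ 1`): then `Δ = D*D`, «the operator ∂*∂ in the Abelian case». [cite: Balaban1985BackgroundPropagators, (3.10) p.392] -/
theorem curvOp_one : curvOp (c₀ := c₀) φ τ η (fun _ : Bond d Pd => (1 : 𝔸ˣ)) = 0 :=
  opOfSesq_eq_zero_of_forall _ fun f g => by rw [curvSesq_apply, curvForm_one]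

omit [StarModule ℂ 𝔸] [FiniteDimensional ℂ W] in
/-- **Under the compatibility `⟨φ⁻¹X, φ⁻¹Y⟩ = τ(X*Y)` the scalar product of the `L²` bond space IS print's `Σ_b η^d tr(A(b)*B(b))`** ((18) / (3.11)) —
the reading under which `curvOp` is the printed `Δ′` («hermitian operator given by the quadratic form»). [cite: Balaban1985Averaging, (18) p.21; Balaban1985BackgroundPropagators, (3.11) p.392] -/
theorem inner_eq_sum_trace (hτ : ∀ X Y : 𝔸, ⟪φ.symm X, φ.symm Y⟫_ℂ = τ (star X * Y)) (f g : BondL2K ℂ d Pd c₀ W) :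
    ⟪f, g⟫_ℂ = ∑ b, (c₀ : ℂ) * τ (star (toAlg φ f b) * toAlg φ g b) := by
  rw [WL2.inner_def]
  refine Finset.sum_congr rfl fun b _ => ?_
  have h : star (toAlg φ f b) * toAlg φ g b = star (φ (WL2.equiv ℂ _ W f b)) * φ (WL2.equiv ℂ _ W g b) := rfl
  rw [h, ← hτ, LinearEquiv.symm_apply_apply, LinearEquiv.symm_apply_apply]
  rfl

/-- **For hermitian-valued `A` (`(ΦA)* = ΦA`) the diagonal `⟪A, Δ′A⟫` IS PRINT'S (3.10)**: `⟪A, Δ′A⟫ = Σ_p η^d [τ((DA)(p)²(Re U(∂p) − 1)) +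
τ((Σ_{b₁≺b₂} i[A′(b₁), A′(b₂)]) η⁻² Im U(∂p))]` (`B9Eq310DeltaPrime.curvForm_apply_self`). [cite: Balaban1985BackgroundPropagators, (3.10) p.392] -/
theorem inner_curvOp_self_of_star_eq (A : BondL2K ℂ d Pd c₀ W) (hA : star (toAlg φ A) = toAlg φ A) :
    ⟪A, curvOp φ τ η U A⟫_ℂ =
      ∑ p : B9SectCLatticeCarrier.Plaq d Pd, ((η : ℂ)) ^ d *
        (τ (B9Eq310DeltaPrime.curlAt ((η : ℂ))⁻¹ U p (toAlg φ A) * B9Eq310DeltaPrime.curlAt ((η : ℂ))⁻¹ U p (toAlg φ A) *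
            (B9Eq310DeltaPrime.reHol U p - 1)) +
          τ ((∑ kl ∈ B9Eq310DeltaPrime.orderedPairs, Complex.I •
              (B9Eq310DeltaPrime.edgeLin U p kl.1 (toAlg φ A) * B9Eq310DeltaPrime.edgeLin U p kl.2 (toAlg φ A) -
                B9Eq310DeltaPrime.edgeLin U p kl.2 (toAlg φ A) * B9Eq310DeltaPrime.edgeLin U p kl.1 (toAlg φ A))) *
            ((((η : ℂ))⁻¹) ^ 2 • B9Eq310DeltaPrime.imHol U p))) := by
  rw [inner_curvOp, hA, B9Eq310DeltaPrime.curvForm_apply_self]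

end Curv

/-! ## §3a (3.9) is the `ℓ²`-adjoint of (3.4) for `𝕜`-inner-product fibres; `D*D` is `D†D` on the `L²` spaces over `𝕜` -/

section CurlK

open B9SectCLatticeCarrier (Bond Plaq DirPair shift unshift)
open B4Sect5Torus (TSite)
open B9Eq311L2Pairing (WL2 adjoint_eq_of_sum_inner)
open B9Eq33CovDerivVector (shiftEquiv)
open B9Eq34CovCurlVector (covCurl covCoCurl covLapPrincipal covCurl_apply_coord covCoCurl_apply)
open B11Eq103H1Complex (BondL2K)

variable {𝕜 : Type*} [RCLike 𝕜] {d : ℕ} {Pd : Fin d → ℕ} {W : Type*} [NormedAddCommGroup W] [InnerProductSpace 𝕜 W]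

/-- **(3.9) is the `ℓ²`-adjoint of the curl (3.4) for `𝕜`-inner-product fibres** (the `𝔤ᶜ`-valued case of
`B9Eq34CovCurlVector.sum_inner_covCurl_eq_sum_inner_covCoCurl`): for a scalar with `conj c = c` and transporter data with `⟨R(b)v, u⟩ = ⟨v, S(b)u⟩`,
`Σ_p ⟨(DA)(p), F(p)⟩ = Σ_b ⟨A(b), (D*F)(b)⟩`. [cite: Balaban1985BackgroundPropagators, (3.9) p.392] -/
theorem sum_inner_covCurl_eq_sum_inner_covCoCurl_K (c : 𝕜) (hc : conj c = c) (R S : Bond d Pd → W →ₗ[𝕜] W)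
    (hRS : ∀ (b : Bond d Pd) (v u : W), ⟪R b v, u⟫_𝕜 = ⟪v, S b u⟫_𝕜) (A : Bond d Pd → W) (F : Plaq d Pd → W) :
    ∑ p, ⟪covCurl c R A p, F p⟫_𝕜 = ∑ b, ⟪A b, covCoCurl c S F b⟫_𝕜 := by
  -- the four families of terms, as functions of (site, pair)
  set T1 : TSite d Pd → DirPair d → 𝕜 := fun x q => c * ⟪A (shift q.1.1 x, q.1.2), S (x, q.1.1) (F (x, q))⟫_𝕜 with hT1
  set T2 : TSite d Pd → DirPair d → 𝕜 := fun x q => c * ⟪A (x, q.1.2), F (x, q)⟫_𝕜 with hT2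
  set T3 : TSite d Pd → DirPair d → 𝕜 := fun x q => c * ⟪A (shift q.1.2 x, q.1.1), S (x, q.1.2) (F (x, q))⟫_𝕜 with hT3
  set T4 : TSite d Pd → DirPair d → 𝕜 := fun x q => c * ⟪A (x, q.1.1), F (x, q)⟫_𝕜 with hT4
  have hL : ∑ p, ⟪covCurl c R A p, F p⟫_𝕜 = ∑ x, ∑ q, (T1 x q - T2 x q - (T3 x q - T4 x q)) := by
    rw [Fintype.sum_prod_type]
    refine Finset.sum_congr rfl fun x _ => Finset.sum_congr rfl fun q _ => ?_
    rw [covCurl_apply_coord, inner_sub_left, inner_smul_left, inner_smul_left, hc, inner_sub_left, inner_sub_left, hRS, hRS,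
      hT1, hT2, hT3, hT4, mul_sub, mul_sub]
  have key1 : ∀ q : DirPair d, ∑ x : TSite d Pd, T1 x q =
      ∑ y : TSite d Pd, c * ⟪A (y, q.1.2), S (unshift q.1.1 y, q.1.1) (F (unshift q.1.1 y, q))⟫_𝕜 := fun q =>
    Fintype.sum_equiv (shiftEquiv q.1.1) _ _ fun x => by
      simp only [hT1, shiftEquiv, Equiv.coe_fn_mk, B9SectCLatticeCarrier.unshift_shift]
  have key3 : ∀ q : DirPair d, ∑ x : TSite d Pd, T3 x q =
      ∑ y : TSite d Pd, c * ⟪A (y, q.1.1), S (unshift q.1.2 y, q.1.2) (F (unshift q.1.2 y, q))⟫_𝕜 := fun q =>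
    Fintype.sum_equiv (shiftEquiv q.1.2) _ _ fun x => by
      simp only [hT3, shiftEquiv, Equiv.coe_fn_mk, B9SectCLatticeCarrier.unshift_shift]
  have hR : ∑ b, ⟪A b, covCoCurl c S F b⟫_𝕜 =
      ∑ y, ((∑ q, (c * ⟪A (y, q.1.2), S (unshift q.1.1 y, q.1.1) (F (unshift q.1.1 y, q))⟫_𝕜 - T2 y q)) -
        ∑ q, (c * ⟪A (y, q.1.1), S (unshift q.1.2 y, q.1.2) (F (unshift q.1.2 y, q))⟫_𝕜 - T4 y q)) := by
    rw [Fintype.sum_prod_type]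
    refine Finset.sum_congr rfl fun y _ => ?_
    have e : ∀ κ : Fin d, ⟪A (y, κ), covCoCurl c S F (y, κ)⟫_𝕜 =
        (∑ q ∈ Finset.univ.filter (fun q : DirPair d => q.1.2 = κ),
            (c * ⟪A (y, q.1.2), S (unshift q.1.1 y, q.1.1) (F (unshift q.1.1 y, q))⟫_𝕜 - T2 y q)) -
          ∑ q ∈ Finset.univ.filter (fun q : DirPair d => q.1.1 = κ),
            (c * ⟪A (y, q.1.1), S (unshift q.1.2 y, q.1.2) (F (unshift q.1.2 y, q))⟫_𝕜 - T4 y q) := by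
      intro κ
      rw [covCoCurl_apply, inner_smul_right, inner_sub_right, inner_sum, inner_sum, mul_sub, Finset.mul_sum, Finset.mul_sum]
      congr 1
      · refine Finset.sum_congr rfl fun q hq => ?_
        rw [Finset.mem_filter] at hq
        rw [inner_sub_right, mul_sub]
        simp only [hT2]
        rw [hq.2]
      · refine Finset.sum_congr rfl fun q hq => ?_
        rw [Finset.mem_filter] at hq
        rw [inner_sub_right, mul_sub]
        simp only [hT4]
        rw [hq.2]
    simp only [e]
    rw [Finset.sum_sub_distrib,
      Finset.sum_fiberwise Finset.univ (fun q : DirPair d => q.1.2)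
        (fun q => c * ⟪A (y, q.1.2), S (unshift q.1.1 y, q.1.1) (F (unshift q.1.1 y, q))⟫_𝕜 - T2 y q),
      Finset.sum_fiberwise Finset.univ (fun q : DirPair d => q.1.1)
        (fun q => c * ⟪A (y, q.1.1), S (unshift q.1.2 y, q.1.2) (F (unshift q.1.2 y, q))⟫_𝕜 - T4 y q)]
  rw [hL, hR]
  simp only [Finset.sum_sub_distrib]
  rw [Finset.sum_comm (f := fun x q => T1 x q), Finset.sum_comm (f := fun x q => T3 x q),
    Finset.sum_comm (f := fun y q => c * ⟪A (y, q.1.2), S (unshift q.1.1 y, q.1.1) (F (unshift q.1.1 y, q))⟫_𝕜),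
    Finset.sum_comm (f := fun y q => c * ⟪A (y, q.1.1), S (unshift q.1.2 y, q.1.2) (F (unshift q.1.2 y, q))⟫_𝕜)]
  simp only [key1, key3]

variable (𝕜) in
/-- The `L²` space of `𝔤ᶜ`-valued PLAQUETTE functions, uniform weight `c₀`, scalars `𝕜`. [cite: Balaban1985BackgroundPropagators, (3.11) p.392] -/
abbrev PlaqL2K (d : ℕ) (Pd : Fin d → ℕ) (c₀ : ℝ) (W : Type*) : Type _ := WL2 𝕜 (fun _ : Plaq d Pd => c₀) W

variable {c₀ : ℝ} [Fact (0 < c₀)]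

variable (𝕜) in
/-- **(3.4) the curl between the `L²` spaces over `𝕜`.** [cite: Balaban1985BackgroundPropagators, (3.4) p.391] -/
def covCurlL2K (c₀ : ℝ) (c : 𝕜) (R : Bond d Pd → W →ₗ[𝕜] W) [Fact (0 < c₀)] : BondL2K 𝕜 d Pd c₀ W →ₗ[𝕜] PlaqL2K 𝕜 d Pd c₀ W :=
  (WL2.linearEquiv 𝕜 𝕜 (fun _ : Plaq d Pd => c₀)).symm.toLinearMap ∘ₗ covCurl c R ∘ₗ
    (WL2.linearEquiv 𝕜 𝕜 (fun _ : Bond d Pd => c₀)).toLinearMap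

variable (𝕜) in
/-- **(3.9) the cocurl between the `L²` spaces over `𝕜`.** [cite: Balaban1985BackgroundPropagators, (3.9) p.392] -/
def covCoCurlL2K (c₀ : ℝ) (c : 𝕜) (S : Bond d Pd → W →ₗ[𝕜] W) [Fact (0 < c₀)] : PlaqL2K 𝕜 d Pd c₀ W →ₗ[𝕜] BondL2K 𝕜 d Pd c₀ W :=
  (WL2.linearEquiv 𝕜 𝕜 (fun _ : Bond d Pd => c₀)).symm.toLinearMap ∘ₗ covCoCurl c S ∘ₗ
    (WL2.linearEquiv 𝕜 𝕜 (fun _ : Plaq d Pd => c₀)).toLinearMap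

/-- Unfolding. [cite: Balaban1985BackgroundPropagators, (3.4) p.391] -/
theorem equiv_covCurlL2K (c : 𝕜) (R : Bond d Pd → W →ₗ[𝕜] W) (A : BondL2K 𝕜 d Pd c₀ W) :
    WL2.equiv 𝕜 _ W (covCurlL2K 𝕜 c₀ c R A) = covCurl c R (WL2.equiv 𝕜 _ W A) := rfl

/-- Unfolding. [cite: Balaban1985BackgroundPropagators, (3.9) p.392] -/
theorem equiv_covCoCurlL2K (c : 𝕜) (S : Bond d Pd → W →ₗ[𝕜] W) (F : PlaqL2K 𝕜 d Pd c₀ W) :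
    WL2.equiv 𝕜 _ W (covCoCurlL2K 𝕜 c₀ c S F) = covCoCurl c S (WL2.equiv 𝕜 _ W F) := rfl

variable [FiniteDimensional 𝕜 W]

/-- **(3.9) IS `LinearMap.adjoint` of (3.4) on the `𝔤ᶜ`-valued `L²` spaces** (uniform weights; `conj c = c`; mutually adjoint transporters).
[cite: Balaban1985BackgroundPropagators, (3.9) p.392] -/
theorem adjoint_covCurlL2K (c : 𝕜) (hc : conj c = c) (R S : Bond d Pd → W →ₗ[𝕜] W)
    (hRS : ∀ (b : Bond d Pd) (v u : W), ⟪R b v, u⟫_𝕜 = ⟪v, S b u⟫_𝕜) :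
    LinearMap.adjoint (covCurlL2K 𝕜 c₀ c R) = covCoCurlL2K 𝕜 c₀ c S := by
  refine adjoint_eq_of_sum_inner _ _ fun A F => ?_
  simp only [← Finset.mul_sum, equiv_covCurlL2K, equiv_covCoCurlL2K]
  congr 1
  exact sum_inner_covCurl_eq_sum_inner_covCoCurl_K c hc R S hRS _ _

/-- **`D*D = D†D`** on the `𝔤ᶜ`-valued `L²` bond space: the principal part of (3.10) is the composite of the curl with its Hilbert adjoint,
hence SYMMETRIC with `⟨A, D*DA⟩ = ‖DA‖²`. [cite: Balaban1985BackgroundPropagators, (3.10) p.392] -/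
theorem covCoCurlL2K_comp_eq_adjoint_comp (c : 𝕜) (hc : conj c = c) (R S : Bond d Pd → W →ₗ[𝕜] W)
    (hRS : ∀ (b : Bond d Pd) (v u : W), ⟪R b v, u⟫_𝕜 = ⟪v, S b u⟫_𝕜) :
    covCoCurlL2K 𝕜 c₀ c S ∘ₗ covCurlL2K 𝕜 c₀ c R = LinearMap.adjoint (covCurlL2K 𝕜 c₀ c R) ∘ₗ covCurlL2K 𝕜 c₀ c R := by
  rw [adjoint_covCurlL2K c hc R S hRS]

/-- `⟨A, D*(DA)⟩ = ‖DA‖²` over `𝕜`. [cite: Balaban1985BackgroundPropagators, (3.10) p.392] -/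
theorem inner_covCoCurlL2K_covCurlL2K (c : 𝕜) (hc : conj c = c) (R S : Bond d Pd → W →ₗ[𝕜] W)
    (hRS : ∀ (b : Bond d Pd) (v u : W), ⟪R b v, u⟫_𝕜 = ⟪v, S b u⟫_𝕜) (A : BondL2K 𝕜 d Pd c₀ W) :
    ⟪A, covCoCurlL2K 𝕜 c₀ c S (covCurlL2K 𝕜 c₀ c R A)⟫_𝕜 = ((‖covCurlL2K 𝕜 c₀ c R A‖ : ℝ) : 𝕜) ^ 2 := by
  rw [← adjoint_covCurlL2K c hc R S hRS, LinearMap.adjoint_inner_right, inner_self_eq_norm_sq_to_K]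

/-- `D*D` is symmetric over `𝕜`. [cite: Balaban1985BackgroundPropagators, (3.10) p.392] -/
theorem covCoCurlL2K_comp_isSymmetric (c : 𝕜) (hc : conj c = c) (R S : Bond d Pd → W →ₗ[𝕜] W)
    (hRS : ∀ (b : Bond d Pd) (v u : W), ⟪R b v, u⟫_𝕜 = ⟪v, S b u⟫_𝕜) :
    (covCoCurlL2K 𝕜 c₀ c S ∘ₗ covCurlL2K 𝕜 c₀ c R).IsSymmetric := by
  rw [covCoCurlL2K_comp_eq_adjoint_comp c hc R S hRS]
  intro x y
  rw [LinearMap.comp_apply, LinearMap.comp_apply, LinearMap.adjoint_inner_left, LinearMap.adjoint_inner_right]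

end CurlK

/-! ## §3 The Hessian `Δ^η(U) = D*D + Δ′` as an operator -/

section Hess

open B9SectCLatticeCarrier (Bond Plaq)
open B4Sect5Torus (TSite)
open B9Eq311L2Pairing (WL2)
open B9Eq33CovDerivVector (adTransport)
open B9Eq34CovCurlVector (covLapPrincipal)
open B11Eq103H1Complex (BondL2K)

variable {d : ℕ} {Pd : Fin d → ℕ} {𝔸 : Type*} [Ring 𝔸] [Algebra ℂ 𝔸] {W : Type*} [NormedAddCommGroup W] [InnerProductSpace ℂ W]
  (φ : W ≃ₗ[ℂ] 𝔸)

/-- The transporter `R(V(b))X = V(b)XV(b)⁻¹` READ ON THE HILBERT FIBRE along `φ`: `φ⁻¹ ∘ R(V(b)) ∘ φ`. [cite: Balaban1985BackgroundPropagators, p.390] -/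
def adTransportW (V : Bond d Pd → 𝔸ˣ) (b : Bond d Pd) : W →ₗ[ℂ] W :=
  φ.symm.toLinearMap ∘ₗ adTransport (𝕜 := ℂ) V b ∘ₗ φ.toLinearMap

/-- Unfolding: `adTransportW φ V b w = φ⁻¹ (V(b) · φ w · V(b)⁻¹)`. [cite: Balaban1985BackgroundPropagators, p.390] -/
theorem adTransportW_apply (V : Bond d Pd → 𝔸ˣ) (b : Bond d Pd) (w : W) :
    adTransportW φ V b w = φ.symm ((V b : 𝔸) * φ w * ((V b)⁻¹ : 𝔸ˣ)) := by
  simp [adTransportW, B9Eq33CovDerivVector.adTransport_apply]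

variable {c₀ : ℝ} (η : ℝ) (U : Bond d Pd → 𝔸ˣ)

/-- **`D*D` of (3.10) ON THE `L²` BOND SPACE OVER `ℂ`**: `B9Eq34CovCurlVector.covLapPrincipal` (curl (3.4) with the transporters `R(U(b))`,
cocurl (3.9) with the adjoint transporters `R(U(b)⁻¹)`, scalar `η⁻¹`) read through the identifications of the weighted `L²` space with the
`W`-valued functions. [cite: Balaban1985BackgroundPropagators, (3.10) p.392, (3.4) p.391, (3.9) p.392] -/
def principalOpK : BondL2K ℂ d Pd c₀ W →ₗ[ℂ] BondL2K ℂ d Pd c₀ W :=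
  (WL2.linearEquiv ℂ ℂ (fun _ : Bond d Pd => c₀)).symm.toLinearMap ∘ₗ
    covLapPrincipal ((η : ℂ))⁻¹ (adTransportW φ U) (adTransportW φ (fun b => (U b)⁻¹)) ∘ₗ
      (WL2.linearEquiv ℂ ℂ (fun _ : Bond d Pd => c₀)).toLinearMap

/-- Unfolding: the function underlying `principalOpK f` is `covLapPrincipal … (f)`. [cite: Balaban1985BackgroundPropagators, (3.10) p.392] -/
theorem equiv_principalOpK (f : BondL2K ℂ d Pd c₀ W) :
    WL2.equiv ℂ _ W (principalOpK φ η U f) =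
      covLapPrincipal ((η : ℂ))⁻¹ (adTransportW φ U) (adTransportW φ (fun b => (U b)⁻¹)) (WL2.equiv ℂ _ W f) := rfl

/-- `D*D` on the `L²` bond space IS the composite `cocurl ∘ curl` of §3a (by `rfl`). [cite: Balaban1985BackgroundPropagators, (3.10) p.392] -/
theorem principalOpK_eq_comp [Fact (0 < c₀)] :
    principalOpK (c₀ := c₀) φ η U =
      covCoCurlL2K ℂ c₀ ((η : ℂ))⁻¹ (adTransportW φ (fun b => (U b)⁻¹)) ∘ₗ covCurlL2K ℂ c₀ ((η : ℂ))⁻¹ (adTransportW φ U) := rfl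

/-- **`D*D` is SYMMETRIC with `⟨A, D*DA⟩ = ‖DA‖²`** when the transporters read on the Hilbert fibre are mutually adjoint
(`⟨R(U(b))v, u⟩ = ⟨v, R(U(b)⁻¹)u⟩` — unitarity of `R(U(b))` in the norming (18); displayed). [cite: Balaban1985BackgroundPropagators, (3.10) p.392] -/
theorem principalOpK_isSymmetric [FiniteDimensional ℂ W] [Fact (0 < c₀)]
    (hRS : ∀ (b : Bond d Pd) (v u : W), ⟪adTransportW φ U b v, u⟫_ℂ = ⟪v, adTransportW φ (fun b => (U b)⁻¹) b u⟫_ℂ) :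
    (principalOpK (c₀ := c₀) φ η U).IsSymmetric := by
  rw [principalOpK_eq_comp]
  exact covCoCurlL2K_comp_isSymmetric _ (by rw [map_inv₀, Complex.conj_ofReal]) _ _ hRS

variable [StarRing 𝔸] [StarModule ℂ 𝔸] [FiniteDimensional ℂ W] [Fact (0 < c₀)] (τ : 𝔸 →ₗ[ℂ] ℂ)

/-- **THE HESSIAN `Δ^η(U) = D*D + Δ′` AS AN OPERATOR** on the `L²` space of `𝔤ᶜ`-valued bond functions — the letter `Δ₁` of
`G₁ = (Δ₁ + DRD* + aQ*Q)⁻¹` ([B11] (110)) as an object of the background (and of `τ`, `φ`). [cite: Balaban1985BackgroundPropagators, (3.10) p.392] -/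
def hessOp : BondL2K ℂ d Pd c₀ W →ₗ[ℂ] BondL2K ℂ d Pd c₀ W := principalOpK φ η U + curvOp φ τ η U

/-- Unfolding `Δ = D*D + Δ′`. [cite: Balaban1985BackgroundPropagators, (3.10) p.392] -/
theorem hessOp_apply (f : BondL2K ℂ d Pd c₀ W) : hessOp φ η U τ f = principalOpK φ η U f + curvOp φ τ η U f := rfl

/-- **At the flat background `Δ = D*D`** — «the operator ∂*∂ in the Abelian case». [cite: Balaban1985BackgroundPropagators, (3.10) p.392] -/
theorem hessOp_one : hessOp (c₀ := c₀) φ η (fun _ : Bond d Pd => (1 : 𝔸ˣ)) τ = principalOpK φ η (fun _ : Bond d Pd => (1 : 𝔸ˣ)) := by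
  rw [hessOp, curvOp_one, add_zero]

end Hess

end Literature.MathematicalPhysics.QuantumFieldTheory.Balaban1983to89.B9Eq310HessianOperator

end
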